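import Summits.Schanuel.Schanuel.Theorems.RootDecomp1KSkelCell03

/-!
# RootDecomp1KSkelCell — lens 1, generations 43–44 «THE QUALITY-ONLY CLASS SkelLiouville ⊋ LogLogLiouville AND ITS CERTIFIED MEMBER ρ⋆» (PRICE K-α L2033, CLAIM L2045, ACK L2046; (α) PROPER of the 1K wall map): the location-free class `SkelLiouville ρ := ∀ m ∃ r, m ≤ den r ∧ ρ ≠ r ∧ |ρ − r| < den^{−m·ι(den)}` (ι q = least N with q ≤ 2^{N!}) with `LogLogLiouville ⊊ SkelLiouville ⊆ Liouville` PROVED, the member ρ⋆ = Σ_j 2^{−2^{e_j}} (FREDHOLM SERIES WITH DELETED BLOCKS) certified HYPOTHESIS-FREE in Skel ∖ (LogLog ∪ FactorialGap), the SKEL engine + extraction, the walls (1, ℓ₂, ρ) mod hNW / π-twins and the pair (ℓ₂, ρ) HYPOTHESIS-FREE for every ρ ∈ Skel, the items APPLIED at z⋆ with all binders discharged, the m = 1 ceiling, and §9 hNW DISCHARGED BY NAME on the e-wall via the Literature proof module — continuation (RootDecomp1KSkelCell04): §6 member theorems + §2 engine preliminaries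

(lens-1 g43/g44 HOME kernel SkelCell.lean EDITION 2 b7163857…, 2822 l, imports tree RootDecomp1KGapCell01 (+ for §9 only Literature ExpOneTranscendenceMeasureProofs); CLAIM L2045, ACK L2046 (CHECKLIST K-α (1)–(8) + the constant-dependence line of L2085 (R4)), NODE L2132 / REQUEST L2133, critic VERDICT L2140 (crit g9: CLEARED — ONE CELL credit (K-α); lens-1 tally credits ×11 + THEOREM; PORT GO in substance 01–0k `--supports stmt-Schanuel-33364`, the two scoped heartbeat raises flagged for the port record, addendum D as RootDecomp1KNWMeasureHolds GO LOW); port by census-1 gen 18 as `RootDecomp1KSkelCell01`–`11` along K's sections: 01 = §1 `iota`, `SkelLiouville`, inclusions `SkelLiouville.liouville` / `logLogLiouville_skelLiouville`; 02 = §5a anchors `aI`/`sI` + §5b the skeleton `eS`, positions `cS`, terms `aS` (up to `summable_aS`); 03 = §5b the member `rhoStar`, truncations `tS`/`rS`, bounds + §6 covering / quality lemmas; 04 = §6 THE MEMBER THEOREMS `skelLiouville_rhoStar`, `not_logLogLiouville_rhoStar`, `not_factorialGapLiouville_rhoStar`, `liouville_rhoStar`, `not_skelLiouville_subset_logLogLiouville`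 + §2 engine preliminaries (`SkelMeasure`, `exists_scale_index_iota`); 05 = §2 THE ENGINE `skelMeasure_cons_liouvilleNumber` (scoped `maxHeartbeats 800000` as in K) + `SkelMeasure.mvWeakMeasure`; 06 = §3 EXTRACTION `no_int_relation_of_skelMeasure_skelLiouville`, `sb_of_skelLiouville_of_skelMeasure`; 07 = §4 THE CELLS (pair hyp-free, walls mod hNW, π-twins) + the live items in item shape; 08 = §7 three interlaced cuts `deletedBlock_margins`, `form_lower_bound_S` (scoped `maxHeartbeats 1600000`); 09 = §7b member tuples zS2/zS3/zS3pi, scope certificates, items AT the members; 10 = §8 the fixed-multiple ladder and the m = 1 ceiling (`uStar`, `skel_fixedOne_ceiling`); 11 = §9 hNW DISCHARGED BY NAME (imports Literature ExpOneTranscendenceMeasureProofs).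
PORT EDITS: `set_option linter.dupNamespace false` dropped; the Literature import moved from the head to part 11 (the only user); K's 13 private helpers travel as per-part private copies; two generic helpers made `private` after the dedup bounce of 02 (p829539: `two_mul_le_two_pow` ≡ Literature.NumberTheory.EllipticCurves.two_mul_le_two_pow; also `log_two_lt_self` pre-emptively) and of 03 (p829791: `one_le_loglog` ≡ Literature Tao2016.EntropyDecrement.one_le_log_log; then nine more generic arithmetic helpers privatised pre-emptively: loglog_pow_pow_ge, add_factorial_mul_le_factorial_add, one_lt_ell2, partialSum_two_two, five_fourths_le_partialSum, ell2_lt, psNumer_two_cast, two_pow_lt_psNumer); statements and proofs verbatim. `--supports stmt-Schanuel-33364`; no census credit carried; rung 0 — nothing here proves Schanuel.)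
-/

open Summit.Schanuel.Schanuel.Theorems.RootDecomp1KHyper
open Summit.Schanuel.Schanuel.Theorems.RootDecomp1KHyper.HyperCell
open Summit.Schanuel.Schanuel.Theorems.RootDecomp1KGeneric
open Summit.Schanuel.Schanuel.Theorems.RootDecomp1KRelLiouvilleCell
open Summit.Schanuel.Schanuel.Theorems.RootDecomp1KLogLogCell
open Summit.Schanuel.Schanuel.Theorems.RootDecomp1KTwoBaseCell
open Summit.Schanuel.Schanuel.Theorems.RootDecomp1KGapCell
open LiouvilleNumber
open scoped Nat

namespace Summit.Schanuel.Schanuel.Theorems.RootDecomp1KSkelCell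

section MemberTheorems

/-- `1 ≤ log log q` for `q ≥ 16`. -/
private theorem one_le_loglog {q : ℝ} (hq : 16 ≤ q) : 1 ≤ Real.log (Real.log q) := by
  have h2 := Real.log_two_gt_d9
  have he := Real.exp_one_lt_d9
  have h16 : Real.log 16 = (4 : ℕ) * Real.log 2 := by
    rw [← Real.log_pow]; norm_num
  have hlog16 : Real.exp 1 ≤ Real.log 16 := by rw [h16]; push_cast; linarith
  have hlogq : Real.log 16 ≤ Real.log q := Real.log_le_log (by norm_num) hq
  rw [Real.le_log_iff_exp_le (by linarith [Real.exp_pos 1])]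
  linarith

/-- `a/2 ≤ log log 2^{2^a}` for `a ≥ 4`. -/
private theorem loglog_pow_pow_ge {a : ℕ} (ha : 4 ≤ a) :
    (a : ℝ) / 2 ≤ Real.log (Real.log ((2 : ℝ) ^ (2 ^ a))) := by
  have h2 := Real.log_two_gt_d9
  have hlog : Real.log ((2 : ℝ) ^ (2 ^ a)) = (2 : ℝ) ^ a * Real.log 2 := by
    rw [Real.log_pow]; push_cast; ring
  have hll : -(1 / 2 : ℝ) ≤ Real.log (Real.log 2) := by
    rw [Real.le_log_iff_exp_le (by linarith)]
    have h1 : 1 + 1 / 2 ≤ Real.exp (1 / 2 : ℝ) := by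
      linarith [Real.add_one_le_exp (1 / 2 : ℝ)]
    have h3 : Real.exp (-(1 / 2 : ℝ)) = 1 / Real.exp (1 / 2) := by rw [Real.exp_neg, inv_eq_one_div]
    rw [h3, div_le_iff₀ (Real.exp_pos _)]
    nlinarith
  rw [hlog, Real.log_mul (by positivity) (by linarith), Real.log_pow]
  have ha' : (4 : ℝ) ≤ a := by exact_mod_cast ha
  nlinarith [mul_le_mul_of_nonneg_left h2.le (by linarith : (0 : ℝ) ≤ a)]

/-- **(M1) `ρ⋆ ∈ SkelLiouville`** — the witness for the parameter `m` is the anchor truncation at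
`i = 2m + 4`: denominator `q = 2^{2^{a_i}}`, `ι(q) ≤ 2^i + 1`, error `≤ 2·2^{−2^{a_i + s_i}} < q^{−m ι(q)}`. -/
theorem skelLiouville_rhoStar : SkelLiouville rhoStar := by
  intro m
  obtain ⟨j, hj, hj1⟩ := eS_anchor (i := 2 * m + 4) (by omega)
  have hcj : cS j = 2 ^ aI (2 * m + 4) := by unfold cS; rw [hj]
  have hcj1 : cS (j + 1) = cS j * 2 ^ sI (2 * m + 4) := by unfold cS; rw [hj1, hj, pow_add]
  have hden := rS_den j
  refine ⟨rS j, ?_, rhoStar_ne_rS j, ?_⟩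
  · rw [hden]
    have h1 : 2 * m + 4 + 1 ≤ aI (2 * m + 4) := succ_le_aI _
    have h2 : aI (2 * m + 4) < 2 ^ aI (2 * m + 4) := Nat.lt_two_pow_self
    have h3 : cS j < 2 ^ cS j := Nat.lt_two_pow_self
    omega
  · have hι : iota (rS j).den ≤ 2 ^ (2 * m + 4) + 1 := by
      rw [hden, hcj]; exact iota_anchor_le _
    have hqual := skel_quality m
    have hexp : cS j * (m * iota (rS j).den) + 1 < cS (j + 1) := by
      rw [hcj1]
      have h1 : m * iota (rS j).den + 2 ≤ 2 ^ sI (2 * m + 4) :=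
        le_trans (by nlinarith [Nat.mul_le_mul_left m hι]) hqual
      have h2 : 1 ≤ cS j := one_le_cS j
      nlinarith [Nat.mul_le_mul_left (cS j) h1]
    have hle := (rhoStar_sub_rS_bounds j).2
    have hge := (rhoStar_sub_rS_bounds j).1
    have hp1 : (0 : ℝ) < 1 / (2 : ℝ) ^ cS (j + 1) := by positivity
    rw [abs_of_nonneg (by linarith), rS_den_cast, ← pow_mul]
    refine hle.trans_lt ?_
    rw [div_lt_div_iff₀ (by positivity) (by positivity), one_mul]
    calc 2 * (2 : ℝ) ^ (cS j * (m * iota (rS j).den))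
        = (2 : ℝ) ^ (cS j * (m * iota (rS j).den) + 1) := by ring
      _ < (2 : ℝ) ^ cS (j + 1) := pow_lt_pow_right₀ (by norm_num) hexp

/-- **(M2) `ρ⋆ ∉ LogLogLiouville`** — STRICTLY BELOW the log-log floor: at the parameter `m = 32` no rational
beats `exp(−32 log q log log q)` (non-truncations are `≥ 1/(32 q³)` away; a filler truncation is `≥ q^{−2}`
away; an anchor truncation is `≥ q^{−2^{s_i}}` away with `2^{s_i} ≤ 8 a_i ≤ 16 log log q`). -/
theorem not_logLogLiouville_rhoStar : ¬ LogLogLiouville rhoStar := by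
  intro h
  obtain ⟨r, hden, hne, hlt⟩ := h 32
  simp only [Nat.cast_ofNat] at hlt
  have hq16 : (16 : ℝ) ≤ r.den := by exact_mod_cast (show 16 ≤ r.den by omega)
  have hq1 : (1 : ℝ) < r.den := by linarith
  have hL : 0 < Real.log r.den := Real.log_pos hq1
  have hLL : 1 ≤ Real.log (Real.log r.den) := one_le_loglog hq16
  refine absurd hlt (not_lt.mpr ?_)
  rcases rhoStar_cover r with ⟨k, rfl⟩ | hfar
  · have hge := (rhoStar_sub_rS_bounds k).1
    have hpos : (0 : ℝ) < 1 / (2 : ℝ) ^ cS (k + 1) := by positivity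
    rw [abs_of_nonneg (by linarith)]
    refine le_trans ?_ hge
    rw [rS_den_cast] at hL hLL ⊢
    rcases eS_step k with hfill | ⟨i, hi, hk, hk1⟩
    · have hc : cS (k + 1) = cS k * 2 := by unfold cS; rw [hfill, pow_succ]
      rw [hc, pow_mul]
      obtain ⟨Q, hQdef⟩ : ∃ Q : ℝ, Q = (2 : ℝ) ^ cS k := ⟨_, rfl⟩
      have hQ0 : 0 < Q := by rw [hQdef]; positivity
      rw [← hQdef] at hL hLL ⊢
      have e : 1 / Q ^ 2 = Real.exp (-(2 * Real.log Q)) := by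
        have e2 : 2 * Real.log Q = Real.log (Q ^ 2) := by rw [Real.log_pow]; norm_num
        rw [Real.exp_neg, e2, Real.exp_log (by positivity), one_div]
      rw [e, Real.exp_le_exp, neg_le_neg_iff]
      nlinarith [mul_le_mul_of_nonneg_left hLL hL.le]
    · have hc : cS (k + 1) = cS k * 2 ^ sI i := by unfold cS; rw [hk1, hk, pow_add]
      have hck : cS k = 2 ^ aI i := by unfold cS; rw [hk]
      have h8 : ((2 ^ sI i : ℕ) : ℝ) ≤ 8 * aI i := by exact_mod_cast two_pow_sI_le_eight_aI (by omega)
      have hll : (aI i : ℝ) / 2 ≤ Real.log (Real.log ((2 : ℝ) ^ cS k)) := by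
        rw [hck]; exact loglog_pow_pow_ge (by have := succ_le_aI i; omega)
      rw [hc, pow_mul]
      obtain ⟨Q, hQdef⟩ : ∃ Q : ℝ, Q = (2 : ℝ) ^ cS k := ⟨_, rfl⟩
      have hQ0 : 0 < Q := by rw [hQdef]; positivity
      rw [← hQdef] at hL hLL hll ⊢
      have e : 1 / Q ^ (2 ^ sI i) = Real.exp (-(((2 ^ sI i : ℕ) : ℝ) * Real.log Q)) := by
        rw [Real.exp_neg, ← Real.log_pow, Real.exp_log (by positivity), one_div]
      rw [e, Real.exp_le_exp, neg_le_neg_iff]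
      push_cast at h8 ⊢
      nlinarith [mul_le_mul_of_nonneg_left hll hL.le, mul_le_mul_of_nonneg_right h8 hL.le]
  · refine le_trans ?_ hfar
    have h32 : Real.log 32 ≤ Real.log r.den :=
      Real.log_le_log (by norm_num) (by exact_mod_cast hden)
    have e : 1 / (32 * (r.den : ℝ) ^ 3) = Real.exp (-(Real.log 32 + 3 * Real.log r.den)) := by
      have e3 : (3 : ℝ) * Real.log r.den = Real.log ((r.den : ℝ) ^ 3) := by
        rw [Real.log_pow]; norm_num
      rw [Real.exp_neg, Real.exp_add, Real.exp_log (by norm_num), e3, Real.exp_log (by positivity),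
        one_div]
    rw [e, Real.exp_le_exp, neg_le_neg_iff]
    nlinarith [mul_le_mul_of_nonneg_left hLL hL.le]

/-- **(M3) `ρ⋆ ∉ FactorialGapLiouville`** — STRICTLY OFF the gap class: at quality `A = 4`, threshold
`K = 3`, no rational with denominator located in a factorial gap approximates `ρ⋆` to order `4`
(non-truncations: `≥ 1/(32q³) ≥ q^{−4}`; filler truncations: `q^{−2}`; an anchor truncation has
`q = 2^{2^{a_i}}` with `(2^i)! < 2^{a_i} ≤ 2 (2^i)!`, incompatible with `2^{4N!} < q`, `q^4 < 2^{(N+1)!}`). -/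
theorem not_factorialGapLiouville_rhoStar : ¬ FactorialGapLiouville rhoStar := by
  intro h
  obtain ⟨N, hN, r, h1, h2, h3⟩ := h 4 3
  have hq0 : (0 : ℝ) < r.den := by exact_mod_cast r.den_pos
  have hq32 : (32 : ℝ) ≤ r.den := by
    have hf : 3 ! ≤ N ! := Nat.factorial_le hN
    have h6 : 5 ≤ 4 * N ! := by simp [Nat.factorial] at hf; omega
    have : (2 : ℝ) ^ 5 ≤ (2 : ℝ) ^ (4 * N !) := pow_le_pow_right₀ (by norm_num) h6
    norm_num at this; linarith
  refine absurd h3 (not_lt.mpr ?_)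
  rcases rhoStar_cover r with ⟨k, rfl⟩ | hfar
  · have hge := (rhoStar_sub_rS_bounds k).1
    have hpos : (0 : ℝ) < 1 / (2 : ℝ) ^ cS (k + 1) := by positivity
    rw [abs_of_nonneg (by linarith)]
    refine le_trans ?_ hge
    rw [rS_den_cast] at h1 h2 ⊢
    rcases eS_step k with hfill | ⟨i, hi, hk, hk1⟩
    · have hc : cS (k + 1) = cS k * 2 := by unfold cS; rw [hfill, pow_succ]
      rw [hc, pow_mul]
      apply one_div_le_one_div_of_le (by positivity)
      exact pow_le_pow_right₀ (one_le_pow₀ (by norm_num)) (by norm_num)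
    · exfalso
      have hck : cS k = 2 ^ aI i := by unfold cS; rw [hk]
      have e1 : 4 * N ! < 2 ^ aI i := hck ▸ (pow_lt_pow_iff_right₀ (by norm_num)).mp h1
      have e2 : 4 * 2 ^ aI i < (N + 1)! := by
        have e : ((2 : ℝ) ^ cS k) ^ 4 = (2 : ℝ) ^ (4 * cS k) := by rw [← pow_mul, mul_comm]
        rw [e] at h2
        exact hck ▸ (pow_lt_pow_iff_right₀ (by norm_num)).mp h2
      have e3 := two_pow_aI_le i
      have e4 := factorial_lt_two_pow_aI i
      have hNM : N < 2 ^ i := by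
        by_contra hc
        have := Nat.factorial_le (not_lt.mp hc)
        omega
      have e5 : (N + 1)! ≤ (2 ^ i)! := Nat.factorial_le hNM
      omega
  · refine le_trans ?_ hfar
    apply one_div_le_one_div_of_le (by positivity)
    nlinarith [mul_le_mul_of_nonneg_right hq32 (by positivity : (0 : ℝ) ≤ (r.den : ℝ) ^ 3)]

/-- **(M4)** `ρ⋆` is a Liouville number (Mathlib's `Liouville`). -/
theorem liouville_rhoStar : Liouville rhoStar := skelLiouville_rhoStar.liouville

/-- `ρ⋆` is irrational-and-then-some: transcendental. -/
theorem transcendental_rhoStar : Transcendental ℤ rhoStar := liouville_rhoStar.transcendental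

/-- **THE CLASS INCLUSION `Skel ⊆ LogLog` FAILS** — witnessed by `ρ⋆`. -/
theorem not_skelLiouville_subset_logLogLiouville : ¬ ∀ ρ : ℝ, SkelLiouville ρ → LogLogLiouville ρ :=
  fun h => not_logLogLiouville_rhoStar (h _ skelLiouville_rhoStar)

/-- `ρ⋆` lies strictly below every class of record: Liouville, but not log-log-, not log-square-,
not log-hyper-, not hyper-Liouville (tree inclusions) and not factorial-gap-Liouville. -/
theorem rhoStar_below_previous_classes :
    Liouville rhoStar ∧ ¬ LogLogLiouville rhoStar ∧ ¬ LogSqLiouville rhoStar ∧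
      ¬ LogHyperLiouville rhoStar ∧ ¬ HyperLiouville rhoStar ∧ ¬ FactorialGapLiouville rhoStar :=
  ⟨liouville_rhoStar, not_logLogLiouville_rhoStar,
    fun h => not_logLogLiouville_rhoStar (logLogLiouville_of_logSqLiouville h),
    fun h => not_logLogLiouville_rhoStar (logLogLiouville_of_logHyperLiouville h),
    fun h => not_logLogLiouville_rhoStar (logLogLiouville_of_hyperLiouville h),
    not_factorialGapLiouville_rhoStar⟩

end MemberTheorems

/-! ## §2  THE ENGINE: the induced SKEL measure of `(ℓ₂, θ)` — a re-proof of the tree's induced measure v2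
(`…LogLogCell.induced_logLog_measure_cons_liouvilleNumber`) that KEEPS the scale index `ι(len)` of the first
admissible factorial scale instead of replacing it by `log log len`.  (The v2 statement is recovered from this
one via `ι ≤ log log`, §1; the converse implication is strict exactly on the lengths in the deleted blocks.) -/

section Engine
open Polynomial

/-- **SKEL measure of algebraic independence**: for every `d` there is `C > 0` with
`|P(θ)| ≥ exp(−C (1 + log len P)(1 + ι(len P)))` for all non-zero `P ∈ ℤ[X₁,…,Xₙ]` of total degree `≤ d`. -/
def SkelMeasure {n : ℕ} (θ : Fin n → ℂ) : Prop :=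
  ∀ d : ℕ, ∃ C : ℝ, 0 < C ∧ ∀ P : MvPolynomial (Fin n) ℤ, P ≠ 0 → P.totalDegree ≤ d →
    Real.exp (-(C * (1 + Real.log ((mvlen P : ℤ) : ℝ)) * (1 + (iota (mvlen P).toNat : ℝ)))) ≤
      ‖MvPolynomial.aeval θ P‖

/-- A tuple with a Skel measure annihilates no nonzero integer polynomial. -/
theorem mvaeval_ne_zero_of_skelMeasure {n : ℕ} {θ : Fin n → ℂ} (hθ : SkelMeasure θ)
    {P : MvPolynomial (Fin n) ℤ} (hP : P ≠ 0) : MvPolynomial.aeval θ P ≠ 0 := by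
  intro h0
  obtain ⟨C, _, h⟩ := hθ P.totalDegree
  have h1 := h P hP le_rfl
  rw [h0, norm_zero] at h1
  exact absurd h1 (not_le.mpr (Real.exp_pos _))

/-- `e + i!·t ≤ (i + (e + t + 1))!`. -/
private theorem add_factorial_mul_le_factorial_add (i e t : ℕ) : e + i ! * t ≤ (i + (e + t + 1))! := by
  have h1 : i ! ≤ (i + (e + t))! := Nat.factorial_le (Nat.le_add_right _ _)
  have h2 : (i + (e + t + 1))! = (i + (e + t) + 1) * (i + (e + t))! := by
    rw [show i + (e + t + 1) = (i + (e + t)) + 1 by omega, Nat.factorial_succ]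
  have h3 : 1 ≤ i ! := Nat.factorial_pos i
  rw [h2]
  calc e + i ! * t ≤ e * i ! + i ! * t + i ! := by nlinarith
    _ = (e + t + 1) * i ! := by ring
    _ ≤ (i + (e + t) + 1) * (i + (e + t))! := Nat.mul_le_mul (by omega) h1

/-- **The first admissible scale, ι-bookkeeping.**  If `1 ≤ Y ≤ 2^e · Lz^t` then the least `N ≥ N_d` with
`2^{N!} ≥ Y` has `N! ≤ N_d! + (ι(Lz) + e + t + 2)·(2 log Y + 1)` — LINEAR in the scale index `ι(Lz)`
(minimality of `N₀`: `(N₀−1)! < 2 log Y + 1`, and `N₀ ≤ ι(Lz) + e + t + 1` since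
`2^{(ι + e + t + 1)!} ≥ 2^{e + ι!·t} ≥ Y`). -/
theorem exists_scale_index_iota {Y : ℝ} (hY1 : 1 ≤ Y) (Nd e t Lz : ℕ)
    (hYle : Y ≤ (2 : ℝ) ^ e * (Lz : ℝ) ^ t) :
    ∃ N : ℕ, Nd ≤ N ∧ Y ≤ 2 ^ N ! ∧
      ((N ! : ℕ) : ℝ) ≤ (Nd ! : ℕ) + ((iota Lz : ℝ) + e + t + 2) * (2 * Real.log Y + 1) := by
  classical
  have hex : ∃ N : ℕ, Y ≤ 2 ^ N ! := by
    refine ⟨⌈Y⌉₊, (Nat.le_ceil Y).trans ?_⟩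
    have h1 : (⌈Y⌉₊ : ℝ) ≤ 2 ^ ⌈Y⌉₊ := by exact_mod_cast (Nat.lt_two_pow_self).le
    exact h1.trans (pow_le_pow_right₀ (by norm_num) (Nat.self_le_factorial _))
  have hlogY : 0 ≤ Real.log Y := Real.log_nonneg hY1
  set T : ℝ := 2 * Real.log Y + 1 with hT
  have hT1 : 1 ≤ T := by rw [hT]; linarith
  have hN₀Y : Y ≤ 2 ^ (Nat.find hex)! := Nat.find_spec hex
  have hbig : Y ≤ (2 : ℝ) ^ (iota Lz + (e + t + 1))! := by
    have h1 : (Lz : ℝ) ≤ (2 : ℝ) ^ (iota Lz)! := by exact_mod_cast iota_spec Lz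
    have h2 : (Lz : ℝ) ^ t ≤ (2 : ℝ) ^ ((iota Lz)! * t) := by
      rw [pow_mul]; exact pow_le_pow_left₀ (by positivity) h1 t
    have h3 := add_factorial_mul_le_factorial_add (iota Lz) e t
    calc Y ≤ (2 : ℝ) ^ e * (Lz : ℝ) ^ t := hYle
      _ ≤ (2 : ℝ) ^ e * (2 : ℝ) ^ ((iota Lz)! * t) := mul_le_mul_of_nonneg_left h2 (by positivity)
      _ = (2 : ℝ) ^ (e + (iota Lz)! * t) := by rw [pow_add]
      _ ≤ (2 : ℝ) ^ (iota Lz + (e + t + 1))! := pow_le_pow_right₀ (by norm_num) h3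
  have hN₀le : Nat.find hex ≤ iota Lz + (e + t + 1) := Nat.find_min' hex hbig
  have hfact : (((Nat.find hex)! : ℕ) : ℝ) ≤ ((Nat.find hex : ℝ) + 1) * T := by
    rcases hk : Nat.find hex with _ | j
    · norm_num [Nat.factorial]; linarith
    · have hmin : ¬ (Y ≤ 2 ^ j !) := Nat.find_min hex (by rw [hk]; omega)
      push Not at hmin
      have hjf : ((j ! : ℕ) : ℝ) < T := by
        have h1 : Real.log ((2 : ℝ) ^ j !) < Real.log Y := Real.log_lt_log (by positivity) hmin
        rw [Real.log_pow] at h1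
        have h2 := Real.log_two_gt_d9
        have h0 : (0 : ℝ) ≤ ((j ! : ℕ) : ℝ) := Nat.cast_nonneg _
        rw [hT]; nlinarith
      rw [Nat.factorial_succ]; push_cast
      have h0 : (0 : ℝ) ≤ (j : ℝ) + 1 := by positivity
      calc ((j : ℝ) + 1) * ((j ! : ℕ) : ℝ) ≤ ((j : ℝ) + 1) * T := mul_le_mul_of_nonneg_left hjf.le h0
        _ ≤ ((j : ℝ) + 1 + 1) * T := by nlinarith
  refine ⟨max Nd (Nat.find hex), le_max_left _ _, ?_, ?_⟩
  · exact hN₀Y.trans (pow_le_pow_right₀ (by norm_num) (Nat.factorial_le (le_max_right _ _)))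
  · have hN₀R : (Nat.find hex : ℝ) + 1 ≤ (iota Lz : ℝ) + e + t + 2 := by
      have : ((Nat.find hex : ℕ) : ℝ) ≤ ((iota Lz + (e + t + 1) : ℕ) : ℝ) := by exact_mod_cast hN₀le
      push_cast at this; linarith
    have hb : (((Nat.find hex)! : ℕ) : ℝ) ≤ ((iota Lz : ℝ) + e + t + 2) * T :=
      hfact.trans (mul_le_mul_of_nonneg_right hN₀R (by linarith))
    rcases le_total Nd (Nat.find hex) with h | h
    · rw [max_eq_right h]
      linarith [hb, (Nat.cast_nonneg (Nd !) : (0 : ℝ) ≤ (Nd ! : ℕ))]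
    · rw [max_eq_left h]
      have : (0 : ℝ) ≤ ((iota Lz : ℝ) + e + t + 2) * T := by positivity
      linarith

/-- For `N ≥ 2` the partial sum `s_N` of `ℓ₂` is `p / 2^{N!}` with `p` ODD and `< 2 · 2^{N!}`
(copy of the tree's LogLogCell03 lemma, which lies outside this file's import cone). -/
private theorem partialSum_two_eq_odd_div' {N : ℕ} (hN : 2 ≤ N) :
    ∃ p : ℕ, Odd p ∧ partialSum 2 N = (p : ℝ) / (2 : ℝ) ^ N ! ∧ p < 2 * 2 ^ N ! := by
  obtain ⟨M, rfl⟩ : ∃ M, N = M + 1 := ⟨N - 1, by omega⟩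
  have hM : 1 ≤ M := by omega
  obtain ⟨p₀, hp₀⟩ := partialSum_eq_rat (m := 2) (by norm_num) M
  simp only [Nat.cast_ofNat] at hp₀
  have hfle : M ! ≤ (M + 1)! := Nat.factorial_le (Nat.le_succ M)
  obtain ⟨e, he⟩ : ∃ e, (M + 1)! = M ! + e := ⟨(M + 1)! - M !, by omega⟩
  have he1 : 1 ≤ e := by
    have h1 : (M + 1)! = (M + 1) * M ! := Nat.factorial_succ M
    have h2 : M ! ≤ M * M ! := Nat.le_mul_of_pos_left _ (by omega)
    have h3 : 1 ≤ M ! := Nat.factorial_pos M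
    have h4 : (M + 1) * M ! = M * M ! + M ! := by ring
    omega
  have heq : partialSum 2 (M + 1) = ((p₀ * 2 ^ e + 1 : ℕ) : ℝ) / (2 : ℝ) ^ (M + 1)! := by
    rw [partialSum_succ, hp₀, he, pow_add]
    have h2 : (0 : ℝ) < 2 ^ M ! := by positivity
    have h2e : (0 : ℝ) < 2 ^ e := by positivity
    push_cast
    field_simp
  refine ⟨p₀ * 2 ^ e + 1, Even.add_one ((Nat.even_pow.mpr ⟨even_two, by omega⟩).mul_left p₀),
    heq, ?_⟩
  have hlt : ((p₀ * 2 ^ e + 1 : ℕ) : ℝ) / 2 ^ (M + 1)! < 2 := by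
    rw [← heq]; linarith [partialSum_two_lt_liouvilleNumber (M + 1), liouvilleNumber_two_lt]
  have hpow : (0 : ℝ) < 2 ^ (M + 1)! := by positivity
  rw [div_lt_iff₀ hpow] at hlt
  exact_mod_cast hlt

end Engine

end Summit.Schanuel.Schanuel.Theorems.RootDecomp1KSkelCell
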